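import Summits.ResolutionOfSingularities.ResolutionOfSingularities.Theorems.FrobeniusClosingPatchingRelPerfectDepthPhaseCLetterLaws
import HarnessLib

/-!
# Crux `PatchingRelPerfect` (stmt-ResolutionOfSingularities-16161), chain W5.2 — F7(β) (β-AX) PHASE C:
# MACHINE-CHECKED STRICT S1♯ RUNS (chart arithmetic) of three named germs — (a) W2 tail, (b) K₃, (c) W1 3-host

[OURS · L1 W5.2 · F7(β) (β-AX) Phase C · X3 `PhaseCTermination₂` raw material · res-L1-w52-plan-1 ADDENDUM G11-19′ (5) (object named
for res-D-repro-1 AS res-L1-repro-3); res-L1-w52-stub-1's letter-law currency `…DepthPhaseCLetterLaws` (p546570) cited for the one-step laws;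
res-L1-w52-idea-1 X3 MEASURE MEMO §5.8 (K₃), res-L1-w52-tri-2 TRIAGE v11.6 Row Z4 / kit j283611 (W1 = `three_a2b2`, W2 = the witness `P`),
res-L1-w52-tri-1 TRIAGE v28 Row 0 addendum kit j283591 (K₃: 5 strict moves).]  Replaces the role of NO printed item; NOT a statement of the
manuscript under review (AI-written, weaker than expert review).  Ring level, ANY commutative ring; every identity is an equality of ideals
obtained from the chart substitution of ONE blow-up followed by the division by the exceptional letter ONCE (weight `ν = 1`, the controlled
transform of spec v4.1 §1 `K_step`), written in the shape `K(substituted) = (exceptional letter) · K′` — or `= (exceptional letter)` when the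
controlled transform `K′` is the UNIT ideal (the chart carries no point of `cosupp K′`: END there vacuously), exactly as in `piT_gChart` /
`germ_eq_span_of_dvd` of the letter-law file.  «END» below = the STRICT currency of record (spec §6 A1 `IsFormatSncOn`: all hosts and members
through the point form ONE snc family) read on the final germ: either `K′ = ⊤` on the chart, or `K′` is displayed as a monomial sum in an
exchanged coordinate family (the r.s.o.p. packaging of such a display is the pattern of `…DepthPhaseCLinearTwoPlanePole` §3 /
`…DepthPhaseCCarrierRsop` `isRsopPart_cons_iff`; it is NOT instantiated in this file).  Which centre S1♯ PICKS at each step is the triagers'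
word (move lists quoted per item); this file certifies the arithmetic of the moves and of every chart, nothing about the strategy.  Every move
below is an INSTANCE of stub-1's named laws — W2 move 1 = `uniaxial_uChart`/`uniaxial_tChart` of `…DepthPhaseCUniaxialLaws` with
(u,m,a,c | b,d) := (y,2,0,1 | 2,z), the strips = `piT_tChart` / `piM_mChart`, K₃ move 5 = the axis/point move (stub-1 STATUS 16:35:06Z) — written out
on the concrete letters and closed by the shared factor law `germ_factor` / `germ_eq_span_of_dvd`, so that the run reads line by line.

## (a) W2 = tri-2's witness `P = (x) + (x + y²) + (t² z)`, members `y, t`, `N`-member `z` — the whole strict tail (every point of `cosupp P` is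
## weak-END and strict non-END; tri-2 `L/res-L1-w52-tri-2/TAILRUNS-input.md` ee55963a16338975 (a) ≡ tri-1 `L/res-L1-w52-tri-1/TAILRUNS-input.md` paths 4/16–18, move for move)
Move 1 (TB2: `ord_W N̄ = 2`): centre `V(x, y, t)`; legality `W2_le_centre`; charts `W2_move1_chartY` (`K = (y)·#7`, `#7 = (x′) + (x′ + y) + (y t′² z)`,
weak-END `#7 = (x′) + (y)` by `W2_childY_weak`), `W2_move1_chartT` (`K = (t)·#2`, `#2 = (x′) + (x′ + t y′²) + (t z)`), `W2_move1_chartX` (`K = (x)`).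
Branch `#7`: move 2′ = `Π_y` (`V(x′, y)`, legality `W2_childY_le_centre`): `W2_tail_chartY` (`#7 = (y)`: second host `x″ + 1`, `K = (1)`), `W2_tail_chartX`
(`#7 = (x′)`).  Branch `#2`: move 2 = `Π_t` (`W2_node2_le_surfaceT`, `W2_move2_T_chartT` → `#3 = (x″) + (x″ + y′²) + (z)`, `W2_move2_T_chartX`); move 3 =
`Bl V(x, y, z)` on `#3` (`W2_node3_le_centre`; `W2_move3_chartY` → `#4 = (x′) + (x′ + y) + (z′)`; `W2_move3_chartZ` = `(z)`, node `#6` END; `W2_move3_chartX`);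
move 4 = `Bl V(x, y, z)` on `#4` (`W2_node4_le_centre`; `W2_move4_chartY` = `(y)`; `W2_move4_chartZ` = `(z)`, node `#5` END; `W2_move4_chartX`) ⇒ worst
case FOUR strict moves, every branch ends with a unit controlled transform (= both triagers' trees).

## (b) K₃ = tri-1's generation-3 cusp pole `(g) + (g + t²uv(u − v)) + (t⁴u²v)`, members `t, u, v` (idea-1 memo §5.8; tri-1 v28 j283591: 5 strict moves)
Moves 1–4 = the strips `Π_t, Π_t, Π_u, Π_v` (memo §5.8 «strips t, t, u, v»; the letter-law instances `piT_tChart`/`piM_mChart` written out):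
`K3_move1_t/g`, `K3_move2_t/g`, `K3_move3_u/g`, `K3_move4_v/g` reach **`K₇ = (g) + (g + (u − v)) + (t² u)`** (tri-1 v28 Row 2's state; weak-END,
strict non-END: `u − v` lies in the span of the members `u, v`).  Move 5 = the member stratum `V(g, u, v)` (memo: «W = V(u, v), admissible»;
legality `K7_le_centre`): `K3_move5_chartU` (`K₇ = (u)·((g′) + (g′ + (1 − v₁)) + (t²))`), `K3_move5_chartV`, `K3_move5_chartG` (`= (g)`); END
leaves: at the point `v₁ = 1` of the `u`-chart, with `w := v₁ − 1`, the germ is `(g′) + (w) + (t²)` (`K3_end_chartU`) — the hosts `g′, g′ − w` and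
the members `u, t` through that point exchange to the chart letters `g′, w, u, t` (the member `v`'s strict transform `V(v₁)` does not pass);
off `v₁ = 1` the germ is `⊤` (`K3_offEnd_chartU`); symmetrically on the `v`-chart (`K3_end_chartV`, no unit hypothesis needed).  FIVE moves.

## (c) W1 = tri-2's `three_a2b2` — in the sibling file `…DepthPhaseCTailRunsThreeHost.lean` (three-host germ notation `Kq[…]`).

What is NOT here: the r.s.o.p./`IsRsopPart` packaging of the END displays; the Rees-chart images (`map_…`, pattern `map_piT_one`); any claim
about which move S1♯ selects (the triagers' tables are quoted, not derived); K₅ / tacnode / diagonal poles; the (α_m) family (stub-1's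
`…DepthPhaseCUniaxialLaws`).

## References
* The Stacks Project, Tags 0804, 0BIQ (affine blow-up algebras and their charts). [StacksProject]
* J. Kollár, *Lectures on Resolution of Singularities* (2007), (3.111) Step 3 (monomial bookkeeping). [Kollar2007]
-/

-- `Summit.<Summit>.<Sub>.Theorems` with `Sub = Summit` (single-conjunct summit, D-0017)
set_option linter.dupNamespace false

noncomputable section

open Literature.AlgebraicGeometry.Resolution

namespace Summit.ResolutionOfSingularities.ResolutionOfSingularities.Theorems

universe u

namespace DepthPhaseC

/-- The two-host germ `K = (g) + (g + φ) + (n)` (stub-1's letter-class notation). -/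
local notation3 "Kl[" g "," φ "," n "]" => (Ideal.span {g} ⊔ Ideal.span {g + φ} ⊔ Ideal.span {n})

section Algebra

variable {A : Type u} [CommRing A]

/-! ## §0 Glue: unit and monomial-sum leaves for the two-host germ -/

/-- **Unit leaf (two hosts)**: if the second host's letter is `g + u` with `u` a unit, the germ is the unit ideal. [folklore] -/
theorem germ_eq_top_of_isUnit (g n : A) {w : A} (hw : IsUnit w) : Kl[g, w, n] = ⊤ := by
  rw [Ideal.eq_top_iff_one]
  obtain ⟨v, hv⟩ := hw.exists_left_inv
  have : v * (g + w) - v * g = 1 := by rw [← hv]; ring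
  rw [← this]
  exact Ideal.sub_mem _ (Ideal.mem_sup_left (Ideal.mem_sup_right (Ideal.mul_mem_left _ _ (Ideal.mem_span_singleton_self _))))
    (Ideal.mem_sup_left (Ideal.mem_sup_left (Ideal.mul_mem_left _ _ (Ideal.mem_span_singleton_self _))))

/-- **Unit leaf via the `N`-member (two hosts)**: if the `N`-summand is a unit the germ is the unit ideal. [folklore] -/
theorem germ_eq_top_of_isUnit_N (g φ : A) {n : A} (hn : IsUnit n) : Kl[g, φ, n] = ⊤ := by
  rw [Ideal.eq_top_iff_one]
  obtain ⟨v, hv⟩ := hn.exists_left_inv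
  rw [← hv]
  exact Ideal.mem_sup_right (Ideal.mul_mem_left _ _ (Ideal.mem_span_singleton_self _))

/-! ## §1 (a) W2 — the witness `P = (x) + (x + y²) + (t² z)` and its tail -/

/-- **Legality of move 1 (`ν = 1`)**: `P ≤ (x, y, t)`. [folklore] -/
theorem W2_le_centre (x y z t : A) : Kl[x, y ^ 2, t ^ 2 * z] ≤ Ideal.span (Set.range ![x, y, t]) := by
  rw [CuspMember.span_range_vec3]
  refine sup_le (sup_le (le_sup_of_le_left le_sup_left) ?_) ?_ <;> rw [Ideal.span_singleton_le_iff_mem]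
  · exact Ideal.add_mem _ (Ideal.mem_sup_left (Ideal.mem_sup_left (Ideal.mem_span_singleton_self x)))
      (Ideal.mem_sup_left (Ideal.mem_sup_right (Ideal.mem_span_singleton.mpr ⟨y, by ring⟩)))
  · exact Ideal.mem_sup_right (Ideal.mem_span_singleton.mpr ⟨t * z, by ring⟩)

/-- **W2 move 1, `y`-chart** (`x = y x′`, `t = y t′`): `P = (y) · ((x′) + (x′ + y) + (y t′² z))` — the child `K_y`. [folklore] -/
theorem W2_move1_chartY (x' y z t' : A) :
    Kl[y * x', y ^ 2, (y * t') ^ 2 * z] = Ideal.span {y} * Kl[x', y, y * t' ^ 2 * z] := by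
  rw [show y ^ 2 = y * y by ring, show (y * t') ^ 2 * z = y * (y * t' ^ 2 * z) by ring, germ_factor]

/-- **The child `K_y` is WEAK-END**: `(x′) + (x′ + y) + (y t′² z) = (x′) + (y)` — a monomial sum in the host `x′` and the member `y`
(strictly it is NOT END: `x′`, `x′ + y`, `y` are dependent). [folklore] -/
theorem W2_childY_weak (x' y z t' : A) : Kl[x', y, y * t' ^ 2 * z] = Ideal.span {x'} ⊔ Ideal.span {y} := by
  rw [germ_eq]
  refine le_antisymm (sup_le le_rfl ?_) le_sup_left
  rw [Ideal.span_singleton_le_iff_mem]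
  exact Ideal.mem_sup_right (Ideal.mem_span_singleton.mpr ⟨t' ^ 2 * z, by ring⟩)

/-- **W2 move 1, `t`-chart** (`x = t x′`, `y = t y′`): `P = (t) · ((x′) + (x′ + t y′²) + (t z))` (the (α)-class continuation, not part of the
tail). [folklore] -/
theorem W2_move1_chartT (x' y' z t : A) :
    Kl[t * x', (t * y') ^ 2, t ^ 2 * z] = Ideal.span {t} * Kl[x', t * y' ^ 2, t * z] := by
  rw [show (t * y') ^ 2 = t * (t * y' ^ 2) by ring, show t ^ 2 * z = t * (t * z) by ring, germ_factor]

/-- **W2 move 1, `x`-chart** (`y = x y′`, `t = x t′`): `P = (x)`. [folklore] -/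
theorem W2_move1_chartX (x y' z t' : A) : Kl[x, (x * y') ^ 2, (x * t') ^ 2 * z] = Ideal.span {x} := by
  rw [show (x * y') ^ 2 = x * (x * y' ^ 2) by ring, show (x * t') ^ 2 * z = x * (x * t' ^ 2 * z) by ring, germ_eq_span_of_dvd]

/-- **Legality of the tail move**: `K_y ≤ (x′, y)`. [folklore] -/
theorem W2_childY_le_centre (x' y z t' : A) : Kl[x', y, y * t' ^ 2 * z] ≤ Ideal.span (Set.range ![x', y]) := by
  rw [W2_childY_weak, CuspMember.span_range_vec2]

/-- **W2 TAIL, `y`-chart** (`x′ = y x″`): `K_y = (y) · ((x″) + (x″ + 1) + (t′² z)) = (y)` — the second host becomes the unit `x″ + 1`,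
the controlled transform is `⊤`: no point of `cosupp` on this chart (END). [folklore] -/
theorem W2_tail_chartY (x'' y z t' : A) : Kl[y * x'', y, y * t' ^ 2 * z] = Ideal.span {y} := by
  have h := germ_factor y x'' 1 (t' ^ 2 * z)
  rw [mul_one, show y * (t' ^ 2 * z) = y * t' ^ 2 * z by ring] at h
  rw [h, germ_eq_top_of_isUnit _ _ isUnit_one, Ideal.mul_top]

/-- **W2 TAIL, `x′`-chart** (`y = x′ y″`): `K_y = (x′)` (END). [folklore] -/
theorem W2_tail_chartX (x' y'' z t' : A) : Kl[x', x' * y'', x' * y'' * t' ^ 2 * z] = Ideal.span {x'} := by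
  rw [show x' * y'' * t' ^ 2 * z = x' * (y'' * t' ^ 2 * z) by ring, germ_eq_span_of_dvd]

/-! ### (a) continued — the `t`-chart branch of move 1 (tri-2 TAILRUNS-input nodes #2 → #3 → #4 → #5/#6; tri-1 paths 16–18): three more moves -/

/-- **Legality of move 2 on the `t`-child** `#2 = (x′) + (x′ + t y′²) + (t z)`: `#2 ≤ (x′, t)`. [folklore] -/
theorem W2_node2_le_surfaceT (x' y' z t : A) : Kl[x', t * y' ^ 2, t * z] ≤ Ideal.span (Set.range ![x', t]) := by
  rw [CuspMember.span_range_vec2]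
  refine sup_le (sup_le le_sup_left ?_) ?_ <;> rw [Ideal.span_singleton_le_iff_mem]
  · exact Ideal.add_mem _ (Ideal.mem_sup_left (Ideal.mem_span_singleton_self _))
      (Ideal.mem_sup_right (Ideal.mem_span_singleton.mpr ⟨y' ^ 2, by ring⟩))
  · exact Ideal.mem_sup_right (Ideal.mem_span_singleton.mpr ⟨z, by ring⟩)

/-- **W2 move 2 on `#2` = `Π_t` (TB2), `t`-chart** (`x′ = t x″`): `#2 = (t) · ((x″) + (x″ + y′²) + (z))` — node `#3`. [folklore] -/
theorem W2_move2_T_chartT (x'' y' z t : A) : Kl[t * x'', t * y' ^ 2, t * z] = Ideal.span {t} * Kl[x'', y' ^ 2, z] :=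
  germ_factor t x'' (y' ^ 2) z

/-- **W2 move 2 on `#2`, `x′`-chart** (`t = x′ t″`): the germ is `(x′)`. [folklore] -/
theorem W2_move2_T_chartX (x' y' z t'' : A) : Kl[x', x' * t'' * y' ^ 2, x' * t'' * z] = Ideal.span {x'} := by
  rw [show x' * t'' * y' ^ 2 = x' * (t'' * y' ^ 2) by ring, show x' * t'' * z = x' * (t'' * z) by ring, germ_eq_span_of_dvd]

/-- **Legality of move 3 on `#3 = (x) + (x + y²) + (z)`**: `#3 ≤ (x, y, z)`. [folklore] -/
theorem W2_node3_le_centre (x y z : A) : Kl[x, y ^ 2, z] ≤ Ideal.span (Set.range ![x, y, z]) := by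
  rw [CuspMember.span_range_vec3]
  refine sup_le (sup_le (le_sup_of_le_left le_sup_left) ?_) le_sup_right
  rw [Ideal.span_singleton_le_iff_mem]
  exact Ideal.add_mem _ (Ideal.mem_sup_left (Ideal.mem_sup_left (Ideal.mem_span_singleton_self x)))
    (Ideal.mem_sup_left (Ideal.mem_sup_right (Ideal.mem_span_singleton.mpr ⟨y, by ring⟩)))

/-- **W2 move 3 on `#3` = `Bl V(x, y, z)` (TB2), `y`-chart** (`x = y x′`, `z = y z′`): `#3 = (y) · ((x′) + (x′ + y) + (z′))` — node `#4`. [folklore] -/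
theorem W2_move3_chartY (x' y z' : A) : Kl[y * x', y ^ 2, y * z'] = Ideal.span {y} * Kl[x', y, z'] := by
  rw [show y ^ 2 = y * y by ring, germ_factor]

/-- **W2 move 3 on `#3`, `z`-chart** (`x = z x′`, `y = z y′`): `#3 = (z)` — the `N`-member becomes `1` (node `#6`, END). [folklore] -/
theorem W2_move3_chartZ (x' y' z : A) : Kl[z * x', (z * y') ^ 2, z] = Ideal.span {z} := by
  have h := germ_factor z x' (z * y' ^ 2) 1
  rw [mul_one, show z * (z * y' ^ 2) = (z * y') ^ 2 by ring] at h
  rw [h, germ_eq_top_of_isUnit_N _ _ isUnit_one, Ideal.mul_top]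

/-- **W2 move 3 on `#3`, `x`-chart** (`y = x y′`, `z = x z′`): the germ is `(x)`. [folklore] -/
theorem W2_move3_chartX (x y' z' : A) : Kl[x, (x * y') ^ 2, x * z'] = Ideal.span {x} := by
  rw [show (x * y') ^ 2 = x * (x * y' ^ 2) by ring, germ_eq_span_of_dvd]

/-- **Legality of move 4 on `#4 = (x) + (x + y) + (z)`**: `#4 ≤ (x, y, z)`. [folklore] -/
theorem W2_node4_le_centre (x y z : A) : Kl[x, y, z] ≤ Ideal.span (Set.range ![x, y, z]) := by
  rw [CuspMember.span_range_vec3]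
  refine sup_le (sup_le (le_sup_of_le_left le_sup_left) ?_) le_sup_right
  rw [Ideal.span_singleton_le_iff_mem]
  exact Ideal.add_mem _ (Ideal.mem_sup_left (Ideal.mem_sup_left (Ideal.mem_span_singleton_self x)))
    (Ideal.mem_sup_left (Ideal.mem_sup_right (Ideal.mem_span_singleton_self y)))

/-- **W2 move 4 on `#4` = `Bl V(x, y, z)` (TB2), `y`-chart** (`x = y x′`, `z = y z′`): `#4 = (y)` — the second host becomes `x′ + 1` (`K = (1)`).
[folklore] -/
theorem W2_move4_chartY (x' y z' : A) : Kl[y * x', y, y * z'] = Ideal.span {y} := by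
  have h := germ_factor y x' 1 z'
  rw [mul_one] at h
  rw [h, germ_eq_top_of_isUnit _ _ isUnit_one, Ideal.mul_top]

/-- **W2 move 4 on `#4`, `z`-chart** (`x = z x′`, `y = z y′`): `#4 = (z)` — the `N`-member becomes `1` (node `#5`, STRICT END). [folklore] -/
theorem W2_move4_chartZ (x' y' z : A) : Kl[z * x', z * y', z] = Ideal.span {z} := by
  have h := germ_factor z x' y' 1
  rw [mul_one] at h
  rw [h, germ_eq_top_of_isUnit_N _ _ isUnit_one, Ideal.mul_top]

/-- **W2 move 4 on `#4`, `x`-chart**: the germ is `(x)`. [folklore] -/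
theorem W2_move4_chartX (x y' z' : A) : Kl[x, x * y', x * z'] = Ideal.span {x} :=
  germ_eq_span_of_dvd x y' z'

/-! ## §2 (b) K₃ — the generation-3 cusp pole and its five strict moves -/

/-- **Legality of `Π_t` at K₃**: `K₃ ≤ (g, t)`. [folklore] -/
theorem K3_le_surfaceT (g u v t : A) :
    Kl[g, t ^ 2 * u * v * (u - v), t ^ 4 * u ^ 2 * v] ≤ Ideal.span (Set.range ![g, t]) := by
  rw [CuspMember.span_range_vec2]
  refine sup_le (sup_le le_sup_left ?_) ?_ <;> rw [Ideal.span_singleton_le_iff_mem]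
  · exact Ideal.add_mem _ (Ideal.mem_sup_left (Ideal.mem_span_singleton_self g))
      (Ideal.mem_sup_right (Ideal.mem_span_singleton.mpr ⟨t * u * v * (u - v), by ring⟩))
  · exact Ideal.mem_sup_right (Ideal.mem_span_singleton.mpr ⟨t ^ 3 * u ^ 2 * v, by ring⟩)

/-- **K₃ move 1 = `Π_t`, `t`-chart** (`g = t g₁`): `(a, b) = (2, 4) ↦ (1, 3)`, `ψ = uv(u − v)`, `μ = u²v` unchanged. [folklore] -/
theorem K3_move1_t (g₁ u v t : A) :
    Kl[t * g₁, t ^ 2 * u * v * (u - v), t ^ 4 * u ^ 2 * v] = Ideal.span {t} * Kl[g₁, t * u * v * (u - v), t ^ 3 * u ^ 2 * v] := by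
  rw [show t ^ 2 * u * v * (u - v) = t * (t * u * v * (u - v)) by ring, show t ^ 4 * u ^ 2 * v = t * (t ^ 3 * u ^ 2 * v) by ring,
    germ_factor]

/-- **K₃ move 1, `g`-chart** (`t = g t′`): the germ is `(g)`. [folklore] -/
theorem K3_move1_g (g u v t' : A) :
    Kl[g, (g * t') ^ 2 * u * v * (u - v), (g * t') ^ 4 * u ^ 2 * v] = Ideal.span {g} := by
  rw [show (g * t') ^ 2 * u * v * (u - v) = g * (g * t' ^ 2 * u * v * (u - v)) by ring,
    show (g * t') ^ 4 * u ^ 2 * v = g * (g ^ 3 * t' ^ 4 * u ^ 2 * v) by ring, germ_eq_span_of_dvd]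

/-- **K₃ move 2 = `Π_t`, `t`-chart** (`g₁ = t g₂`): `(1, 3) ↦ (0, 2)`. [folklore] -/
theorem K3_move2_t (g₂ u v t : A) :
    Kl[t * g₂, t * u * v * (u - v), t ^ 3 * u ^ 2 * v] = Ideal.span {t} * Kl[g₂, u * v * (u - v), t ^ 2 * u ^ 2 * v] := by
  rw [show t * u * v * (u - v) = t * (u * v * (u - v)) by ring, show t ^ 3 * u ^ 2 * v = t * (t ^ 2 * u ^ 2 * v) by ring, germ_factor]

/-- **K₃ move 2, `g`-chart** (`t = g₁ t′`): the germ is `(g₁)`. [folklore] -/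
theorem K3_move2_g (g₁ u v t' : A) :
    Kl[g₁, (g₁ * t') * u * v * (u - v), (g₁ * t') ^ 3 * u ^ 2 * v] = Ideal.span {g₁} := by
  rw [show (g₁ * t') * u * v * (u - v) = g₁ * (t' * u * v * (u - v)) by ring,
    show (g₁ * t') ^ 3 * u ^ 2 * v = g₁ * (g₁ ^ 2 * t' ^ 3 * u ^ 2 * v) by ring, germ_eq_span_of_dvd]

/-- **Legality of `Π_u`** at the move-2 state: `(g₂) + (g₂ + uv(u − v)) + (t²u²v) ≤ (g₂, u)`. [folklore] -/
theorem K3_state2_le_surfaceU (g₂ u v t : A) :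
    Kl[g₂, u * v * (u - v), t ^ 2 * u ^ 2 * v] ≤ Ideal.span (Set.range ![g₂, u]) := by
  rw [CuspMember.span_range_vec2]
  refine sup_le (sup_le le_sup_left ?_) ?_ <;> rw [Ideal.span_singleton_le_iff_mem]
  · exact Ideal.add_mem _ (Ideal.mem_sup_left (Ideal.mem_span_singleton_self _))
      (Ideal.mem_sup_right (Ideal.mem_span_singleton.mpr ⟨v * (u - v), by ring⟩))
  · exact Ideal.mem_sup_right (Ideal.mem_span_singleton.mpr ⟨t ^ 2 * u * v, by ring⟩)

/-- **K₃ move 3 = `Π_u`, `u`-chart** (`g₂ = u g₃`): `ψ, μ` lose the factor `u`. [folklore] -/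
theorem K3_move3_u (g₃ u v t : A) :
    Kl[u * g₃, u * v * (u - v), t ^ 2 * u ^ 2 * v] = Ideal.span {u} * Kl[g₃, v * (u - v), t ^ 2 * u * v] := by
  rw [show u * v * (u - v) = u * (v * (u - v)) by ring, show t ^ 2 * u ^ 2 * v = u * (t ^ 2 * u * v) by ring, germ_factor]

/-- **K₃ move 3, `g`-chart** (`u = g₂ u′`): the germ is `(g₂)`. [folklore] -/
theorem K3_move3_g (g₂ u' v t : A) :
    Kl[g₂, (g₂ * u') * v * (g₂ * u' - v), t ^ 2 * (g₂ * u') ^ 2 * v] = Ideal.span {g₂} := by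
  rw [show (g₂ * u') * v * (g₂ * u' - v) = g₂ * (u' * v * (g₂ * u' - v)) by ring,
    show t ^ 2 * (g₂ * u') ^ 2 * v = g₂ * (g₂ * t ^ 2 * u' ^ 2 * v) by ring, germ_eq_span_of_dvd]

/-- **K₃ move 4 = `Π_v`, `v`-chart** (`g₃ = v g₄`): reaches **`K₇ = (g₄) + (g₄ + (u − v)) + (t² u)`**. [folklore] -/
theorem K3_move4_v (g₄ u v t : A) :
    Kl[v * g₄, v * (u - v), t ^ 2 * u * v] = Ideal.span {v} * Kl[g₄, u - v, t ^ 2 * u] := by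
  rw [show t ^ 2 * u * v = v * (t ^ 2 * u) by ring, germ_factor]

/-- **K₃ move 4, `g`-chart** (`v = g₃ v′`): the germ is `(g₃)`. [folklore] -/
theorem K3_move4_g (g₃ u v' t : A) :
    Kl[g₃, (g₃ * v') * (u - g₃ * v'), t ^ 2 * u * (g₃ * v')] = Ideal.span {g₃} := by
  rw [show (g₃ * v') * (u - g₃ * v') = g₃ * (v' * (u - g₃ * v')) by ring,
    show t ^ 2 * u * (g₃ * v') = g₃ * (t ^ 2 * u * v') by ring, germ_eq_span_of_dvd]

/-- **`K₇` is WEAK-END**: `(g) + (g + (u − v)) + (t² u) = (g) + (u − v) + (t² u)`, a monomial sum in the sub-family `{g, u − v, t, u}`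
(strictly NOT END: `u − v` lies in the span of the members `u, v` — tri-1 v28 Row 2, tri-2 v11.6a Z11). [folklore] -/
theorem K7_weak (g u v t : A) : Kl[g, u - v, t ^ 2 * u] = Ideal.span {g} ⊔ Ideal.span {u - v} ⊔ Ideal.span {t ^ 2 * u} :=
  germ_eq g (u - v) (t ^ 2 * u)

/-- **Legality of move 5**: `K₇ ≤ (g, u, v)` (the member stratum). [folklore] -/
theorem K7_le_centre (g u v t : A) : Kl[g, u - v, t ^ 2 * u] ≤ Ideal.span (Set.range ![g, u, v]) := by
  rw [CuspMember.span_range_vec3]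
  refine sup_le (sup_le (le_sup_of_le_left le_sup_left) ?_) ?_ <;> rw [Ideal.span_singleton_le_iff_mem]
  · rw [show g + (u - v) = (g + u) - v by ring]
    exact Ideal.sub_mem _ (Ideal.add_mem _ (Ideal.mem_sup_left (Ideal.mem_sup_left (Ideal.mem_span_singleton_self g)))
      (Ideal.mem_sup_left (Ideal.mem_sup_right (Ideal.mem_span_singleton_self u)))) (Ideal.mem_sup_right (Ideal.mem_span_singleton_self v))
  · exact Ideal.mem_sup_left (Ideal.mem_sup_right (Ideal.mem_span_singleton.mpr ⟨t ^ 2, by ring⟩))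

/-- **K₃ move 5, `u`-chart** (`g₄ = u g₅`, `v = u v₁`): `K₇ = (u) · ((g₅) + (g₅ + (1 − v₁)) + (t²))`. [folklore] -/
theorem K3_move5_chartU (g₅ u v₁ t : A) :
    Kl[u * g₅, u - u * v₁, t ^ 2 * u] = Ideal.span {u} * Kl[g₅, 1 - v₁, t ^ 2] := by
  rw [show u - u * v₁ = u * (1 - v₁) by ring, show t ^ 2 * u = u * t ^ 2 by ring, germ_factor]

/-- **END leaf on the `u`-chart, at the point `v₁ = 1`** (local letter `w = v₁ − 1`): the germ is `(g₅) + (w) + (t²)` — a monomial sum in the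
exchanged family `g₅, w, t` (hosts `g₅`, `g₅ − w`; members `u`, `t` through the point; the member `v`'s strict transform `V(v₁)` misses it).
[cite: Kollar2007, (3.111) Step 3] -/
theorem K3_end_chartU (g₅ w t : A) :
    Kl[g₅, 1 - (1 + w), t ^ 2] = Ideal.span {g₅} ⊔ Ideal.span {w} ⊔ Ideal.span {t ^ 2} := by
  rw [show (1 : A) - (1 + w) = -w by ring, germ_eq, Ideal.span_singleton_neg]

/-- **Off the END point on the `u`-chart** (`1 − v₁` a unit): the germ is `⊤` (no point of `cosupp`). [folklore] -/
theorem K3_offEnd_chartU (g₅ v₁ t : A) (h : IsUnit (1 - v₁)) : Kl[g₅, 1 - v₁, t ^ 2] = ⊤ :=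
  germ_eq_top_of_isUnit g₅ (t ^ 2) h

/-- **K₃ move 5, `v`-chart** (`g₄ = v g₅`, `u = v u₁`): `K₇ = (v) · ((g₅) + (g₅ + (u₁ − 1)) + (t² u₁))`. [folklore] -/
theorem K3_move5_chartV (g₅ u₁ v t : A) :
    Kl[v * g₅, v * u₁ - v, t ^ 2 * (v * u₁)] = Ideal.span {v} * Kl[g₅, u₁ - 1, t ^ 2 * u₁] := by
  rw [show v * u₁ - v = v * (u₁ - 1) by ring, show t ^ 2 * (v * u₁) = v * (t ^ 2 * u₁) by ring, germ_factor]

/-- **END leaf on the `v`-chart, at the point `u₁ = 1`** (`w = u₁ − 1`): the germ is `(g₅) + (w) + (t²)` — `t² (1 + w) ≡ t² (mod w)`, so no unit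
hypothesis is needed. [cite: Kollar2007, (3.111) Step 3] -/
theorem K3_end_chartV (g₅ w t : A) :
    Kl[g₅, (1 + w) - 1, t ^ 2 * (1 + w)] = Ideal.span {g₅} ⊔ Ideal.span {w} ⊔ Ideal.span {t ^ 2} := by
  rw [show (1 : A) + w - 1 = w by ring, germ_eq]
  refine sup_span_singleton_congr ?_
  rw [show t ^ 2 * (1 + w) - t ^ 2 = t ^ 2 * w by ring]
  exact Ideal.mem_sup_right (Ideal.mem_span_singleton.mpr ⟨t ^ 2, by ring⟩)

/-- **K₃ move 5, `g`-chart** (`u = g₄ u′`, `v = g₄ v′`): the germ is `(g₄)`. [folklore] -/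
theorem K3_move5_chartG (g₄ u' v' t : A) :
    Kl[g₄, g₄ * u' - g₄ * v', t ^ 2 * (g₄ * u')] = Ideal.span {g₄} := by
  rw [show g₄ * u' - g₄ * v' = g₄ * (u' - v') by ring, show t ^ 2 * (g₄ * u') = g₄ * (t ^ 2 * u') by ring, germ_eq_span_of_dvd]

end Algebra

end DepthPhaseC

end Summit.ResolutionOfSingularities.ResolutionOfSingularities.Theorems

end
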